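import Mathlib.Analysis.SpecificLimits.Normed
import Literature.Geometry.Lorentzian.SelfSimilarVacuumProfile
import Literature.Geometry.Lorentzian.SelfSimilarUnstableMode
import Literature.Geometry.Lorentzian.TangentProfile
import HarnessLib

/-!
# Homothety-adapted charts of a self-similar vacuum profile

Definition item `defn-IsHomothetyAdaptedChart` (D3 of route `FinalStateConjecture/HomotheticSurfaceGravity`;
in content also `TangentProfileCensorship`'s `SmoothProfileInstability`): the bridge from the *bundled*
self-similar vacuum profile `Z : SelfSimilarVacuumProfile n` of `SelfSimilarVacuumProfile.lean` (carrier `M`,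
discrete homothety `Φ = Z.dilation`, `Φ^* g = e^{2Δ} g`, `Δ = Z.logScale > 0`, past of the vertex
`Z.past = {v < 0}`, vertex past cone `Z.cone = {v = 0}`) to the *chart-level* predicate
`HasSmoothUnstableMode Zc scales U m` of `SelfSimilarUnstableMode.lean` (components
`Zc : E4 → E4 →L[ℝ] E4 →L[ℝ] ℝ`, vertex at the origin, homothety acting by the dilations `x ↦ c • x`,
`c ∈ scales`).

In the critical-collapse literature a continuously self-similar spacetime (homothetic field `ξ`,
`ℒ_ξ g = 2g`) is written in **coordinates adapted to the symmetry** `(τ, xⁱ)`, `ξ = -∂_τ`, in which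
`g_{μν}(τ, xⁱ) = e^{-2τ} g̃_{μν}(xⁱ)`, and a discretely self-similar one in coordinates in which `g̃_{μν}`
is moreover allowed to be `Δ`-periodic in `τ` (Gundlach–Martín-García 2007, §2.2; "the remaining three
coordinates `xⁱ` can be thought of as angles around the singular spacetime point `τ = ∞`"). Passing to the
Cartesian-type coordinates `X = e^{-τ} ι(xⁱ)` (the convention of `SelfSimilarUnstableMode.lean` and of the
self-similar double-null coordinates of Rodnianski–Shlapentokh-Rothman 2023, Def. 2.3, in which the scaling
vector field is `K = u∂_u + v∂_v` and the scaling maps are `(u, v, θ) ↦ (au, av, θ)`), the homothety acts by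
the linear dilations `X ↦ e^{s} X`, the singular point (vertex) is the ideal point `X = 0`, and
`ℒ_K g = 2g` / `Φ^* g = e^{2Δ} g` become the statement that the metric COMPONENTS are homogeneous of
degree `0`: `g_{αβ}(cX) = g_{αβ}(X)` for all `c > 0` (CSS), resp. for `c = e^{-Δ}` (DSS).

## Contents

* `IsDilationAdaptedChart I Φ c W ψ` (generic; `M` a manifold with model `I`, `Φ : M → M` a self-map —
  the CONTRACTION —, `c : ℝ` its scale factor, `W ⊆ M`, `ψ : M → F` with `F` a real normed space): `W`
  is open and `Φ`-invariant (`Φ '' W = W`), `ψ` is a `C^∞` diffeomorphism of `W` onto the open set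
  `ψ '' W ⊆ F` (smooth on `W`, open image, a smooth left inverse on the image), `ψ` **intertwines `Φ`
  with the linear dilation by `c`**, `ψ (Φ x) = c • ψ x` on `W`, and `ψ ≠ 0` on `W` (the fixed point `0`
  of the dilation is the ideal vertex, not a point of the chart). API: `injOn`, `mapsTo`, the canonical
  inverse `Function.invFunOn ψ W` (`leftInvOn_invFunOn`, `apply_invFunOn`, `contMDiffOn_invFunOn`,
  `mfderiv_invFunOn_mfderiv`, `mfderiv_mfderiv_invFunOn`), openness (`isOpen_image_of_subset`,
  `isOpenEmbedding_restrict`), dilation invariance of the image (`smul_image_eq`, `smul_mem_image_iff`),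
  orbits `ψ (Φ^[k] x) = c^k • ψ x → 0` (`apply_iterate`, `tendsto_apply_iterate`,
  `zero_mem_closure_image`: the vertex sits at the origin).
* `pushforwardBilin I ψ W b` (generic): the components `(ψ|_W⁻¹)^* b` on `ψ '' W` of a field `b` of
  bilinear forms on the tangent spaces of `M`, extended by `0` (junk) off `ψ '' W`; for an adapted chart,
  `ψ` is an "isometry" onto its image (`pushforwardBilin_apply_mfderiv`), the components are
  nondegenerate where `b` is (`pushforwardBilin_nondegenerate`), and — the **scaling law** — if
  `Φ^* b = c² b` then the components are invariant under the dilation by `c`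
  (`IsDilationAdaptedChart.pushforwardBilin_smul`).
* `SelfSimilarVacuumProfile.IsHomothetyAdaptedChart Z W ψ` — **homothety-adapted chart of a profile**:
  `IsDilationAdaptedChart (𝓡 4) Z.dilation.symm (exp (-Δ)) W ψ`, i.e. `ψ (Φ⁻¹ x) = e^{-Δ} • ψ x` on the
  `Φ`-invariant open set `W` (intended: `W = Z.past ∪ N`, `N` a `Φ`-invariant open neighbourhood of
  `Z.cone`); `SelfSimilarVacuumProfile.chartMetric Z W ψ = (ψ|_W⁻¹)^* g`, with the scaling law
  `chartMetric (e^{-Δ} • y) = chartMetric y` (`IsHomothetyAdaptedChart.chartMetric_smul`: the components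
  are invariant under the admissible scale factor `e^{-Δ}`, exactly the DSS form of dilation invariance
  quoted in `SelfSimilarUnstableMode.lean` with `scales = {Real.exp (-Δ)}`), `e^{-Δ} • ψ '' Z.past =
  ψ '' Z.past` (`smul_image_past`), `0 ∉ ψ '' W`, `ψ (Φ^{-k} x) = e^{-kΔ} ψ x → 0`.
* `SelfSimilarVacuumProfile.HasSmoothUnstableModeInChart Z W ψ m`: the bridge proper,
  `HasSmoothUnstableMode (Z.chartMetric W ψ) {Real.exp (-Z.logScale)} (ψ '' W) m`.
* Sanity (`Minkowski`): the identity chart of `ℝ⁴ ∖ {0}` is a dilation-adapted chart for the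
  contraction `x ↦ c • x` (`Minkowski.isDilationAdaptedChart_id`), and the components of the
  Minkowski form in it are the (constant, hence dilation invariant) Minkowski form
  (`Minkowski.pushforwardBilin_id_apply`).

## Design choices

* **A chart is a diffeomorphism onto its image.** The local parametrisations of `TangentProfile.lean`
  only PULL BACK, so smooth open embeddings suffice there; here the metric is PUSHED FORWARD
  (`(ψ⁻¹)^* g`), which is a Lorentzian metric on `ψ '' W` only if `ψ⁻¹` is smooth, so a smooth left
  inverse on the (open) image is part of the notion (`exists_leftInvOn`); injectivity and openness of
  `ψ|_W` are then consequences (`injOn`, `isOpenEmbedding_restrict`). The inverse used in all formulas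
  is Mathlib's canonical `Function.invFunOn ψ W`.
* **The contraction, not the expansion, is linearised**, with the factor `e^{-Δ} ∈ (0, 1)`, matching the
  admissible scale set `{Real.exp (-Δ)}` of `MetricCoord.IsModeSolution`; the expansion form
  `ψ (Φ x) = e^{Δ} • ψ x` is `IsHomothetyAdaptedChart.apply_dilation`.
* **`W` is a parameter.** Which invariant region carries the chart (the past of the vertex, a
  neighbourhood of its closure, …) is for the user to say (`Z.past ⊆ W`, `Z.cone ⊆ W`); nothing here
  asserts that a given profile admits an adapted chart on a given region — that is a statement the
  route files, not part of the definition.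
* **Twisted profiles need no generalisation of the action.** One might allow `ψ ∘ Φ⁻¹ = A ∘ ψ` with
  `A = e^{-Δ} R`, `R` linear (a Lorentz transformation), and generalise the homogeneity clause of
  `MetricCoord.IsModeSolution` accordingly. We deliberately do NOT: (i) the "twist" of the twisted
  self-similar solutions is a property of the metric relative to the cone — the homothetic field `K` is
  spacelike on part of it (Shlapentokh-Rothman 2023, Rem. 4.3) and the shift `b` does not vanish there
  (Rodnianski–Shlapentokh-Rothman 2023, §3, discussion after Rem. 3.1: "the scaling symmetry [induces]
  a twist along the spheres") — not of the ACTION of the homothety: by Shlapentokh-Rothman 2023, Def. 4.1 the orbits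
  of `K` are the curves of constant `(q, θ^A)` and in the homothetic gauge `K = t∂_t` (Def. 4.2), so
  `X = (-t) ι(ρ, θ^A)` is a chart in which the homothety is a pure dilation; (ii) where the regular
  coordinates across the cone are anisotropically homogeneous — `K = u∂_u + (1-2κ) v̂ ∂_v̂` in the
  coordinates `(u, v̂, θ)` of Rodnianski–Shlapentokh-Rothman 2023, Lemma 3.1 — the substitution
  `w = v̂ (-u)^{2κ}`, smooth with smooth inverse on `{u < 0}`, gives `K = u∂_u + w∂_w` without changing
  the regularity class across `{v̂ = 0} = {w = 0}`; (iii) the mode predicate it must feed is stated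
  for scalar dilations only. So the notion covers continuously and discretely, twisted and untwisted
  self-similar profiles, always in the untwisted (pure dilation) normal form of the chart.
* **Generality.** The generic layer is stated for any manifold, self-map and normed target (it is what
  the Minkowski sanity check instantiates, the profile structure not being inhabited in the tree); the
  profile layer fixes `I = 𝓡 4`, `F = E4`, `Φ = Z.dilation.symm`, `c = e^{-Δ}`.
* **Not here:** smoothness of `chartMetric` on `ψ '' W` (it is the smoothness of `pullbackBilin`,
  a named fact `contMDiff_pullbackBilin` of `Isometry.lean`, to be threaded by users); Ricci-flatness of
  the components (the identification of `MetricCoord.ricAt (chartMetric …)` with `Z.metric.ricci` is the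
  business of `ChartMetricCoord.lean`-type bridges); the CSS variant (a chart conjugating the whole
  flow of a homothetic field `K` to all dilations, `scales = Set.Ioi 0`) — the profile structure
  carries only the discrete homothety `Φ`, and a chart adapted to `Φ = φ_Δ` gives the (weaker,
  `HasSmoothUnstableMode.anti`) Floquet form; any existence statement.

## References

* C. Gundlach, J. M. Martín-García, *Critical phenomena in gravitational collapse*, Living Rev.
  Relativ. 10 (2007) 5, §2.2 (CSS/DSS, coordinates adapted to the symmetry,
  `g_{μν}(τ,xⁱ) = e^{-2τ} g̃_{μν}`). [GundlachMartingarcia2007]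
* I. Rodnianski, Y. Shlapentokh-Rothman, *Naked singularities for the Einstein vacuum equations: the
  exterior solution*, Ann. of Math. 198 (2023), Def. 2.3 (self-similar double-null coordinates,
  `K = u∂_u + v∂_v`), Def. 3.1 and Lemma 3.1 (`κ`-self-similarity, `K = u∂_u + (1-2κ)v̂∂_v̂`).
  [RodnianskiShlapentokhRothman2023]
* Y. Shlapentokh-Rothman, *Twisted self-similarity and the Einstein vacuum equations*, CMP 401 (2023),
  Def. 4.1, Def. 4.2, Rem. 4.3. [ShlapentokhRothman2023twisted]
* O. Costin, R. Donninger, I. Glogić, CMP 351 (2016), §2.2; R. Donninger, F. Moscatelli,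
  arXiv:2601.19515, §2.2 (mode ansatz in similarity coordinates, regularity across the cone).
  [CostinDonningerGlogic2016] [DonningerMoscatelli2026]
* B. O'Neill, *Semi-Riemannian geometry*, 1983, Ch. 1, pp. 1–5 (coordinate systems are the
  diffeomorphisms of open sets onto open subsets of `ℝⁿ`), Ch. 3, pp. 55–58 (components `g_{ij}`,
  pullback, Def. 6: isometries), Def. 3.63–Remark 3.65 (homotheties). [ONeill1983]
-/

noncomputable section

open Bundle Set Function Filter Topology
open scoped Manifold ContDiff Topology Pointwise

namespace Literature.Geometry.Lorentzian

section Generic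

variable {E : Type*} [NormedAddCommGroup E] [NormedSpace ℝ E] {H : Type*} [TopologicalSpace H]
  (I : ModelWithCorners ℝ E H) {M : Type*} [TopologicalSpace M] [ChartedSpace H M]
  {F : Type*} [NormedAddCommGroup F] [NormedSpace ℝ F]

/-! ### Dilation-adapted charts (generic layer) -/

/-- A **dilation-adapted chart** for the self-map `Φ` of the manifold `M` (the contraction of a
discrete homothety) with scale factor `c`, on the region `W`, with values in the normed space `F`:
`W` is open and `Φ`-invariant (`Φ '' W = W`); `ψ` is `C^∞` on `W`, has open image `ψ '' W` and a `C^∞`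
left inverse on that image (so `ψ|_W` is a diffeomorphism onto the open set `ψ '' W`, a coordinate system
on `W` in the sense of O'Neill 1983, Ch. 1, pp. 1–5, when `F = ℝᵈ`); **`ψ` conjugates `Φ` to the linear
dilation by `c`**, `ψ (Φ x) = c • ψ x` for `x ∈ W` (the coordinates are *adapted to the symmetry*,
Gundlach–Martín-García 2007, §2.2, in the Cartesian form `X = e^{-τ} ι(xⁱ)` in which the homothety acts
by dilations and the singular point is `X = 0`; cf. Rodnianski–Shlapentokh-Rothman 2023, Def. 2.3, whose
scaling vector field `K = u∂_u + v∂_v` generates the dilations `(u,v,θ) ↦ (e^s u, e^s v, θ)`); and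
`ψ x ≠ 0` on `W` (the fixed point of the dilation is the ideal vertex). [cite: GundlachMartingarcia2007, §2.2] -/
structure IsDilationAdaptedChart (Φ : M → M) (c : ℝ) (W : Set M) (ψ : M → F) : Prop where
  /-- The chart domain is open. -/
  isOpen : IsOpen W
  /-- The chart domain is invariant: `Φ(W) = W`. -/
  image_eq : Φ '' W = W
  /-- `ψ` is smooth on `W`. -/
  contMDiffOn : ContMDiffOn I 𝓘(ℝ, F) ∞ ψ W
  /-- The image `ψ(W)` is open. -/
  isOpen_image : IsOpen (ψ '' W)
  /-- `ψ|_W` has a smooth left inverse defined on its image. -/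
  exists_leftInvOn : ∃ χ : F → M, ContMDiffOn 𝓘(ℝ, F) I ∞ χ (ψ '' W) ∧ LeftInvOn χ ψ W
  /-- `ψ` intertwines `Φ` with the dilation by `c`. -/
  apply_map : ∀ x ∈ W, ψ (Φ x) = c • ψ x
  /-- The origin (the vertex) is not in the chart image. -/
  apply_ne_zero : ∀ x ∈ W, ψ x ≠ 0

/-- The **components in the chart `ψ|_W`** of a field `b` of continuous bilinear forms on the tangent
spaces of `M`: on `ψ '' W` the pullback `(ψ|_W⁻¹)^* b` along the canonical inverse
`Function.invFunOn ψ W` (`(χ^* b)_y(v, w) = b_{χ y}(dχ v, dχ w)`, the pullback of O'Neill 1983, Ch. 3,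
p. 58; for a coordinate system and `b = g` these are the components `g_{ij} = ⟨∂_i, ∂_j⟩`, ibid. Ch. 3,
pp. 55–56), extended by the junk value `0` off `ψ '' W`. [cite: ONeill1983, Ch. 3, pp. 55–58] -/
def pushforwardBilin [Nonempty M] (ψ : M → F) (W : Set M)
    (b : Π x : M, TangentSpace I x →L[ℝ] TangentSpace I x →L[ℝ] ℝ) : F → F →L[ℝ] F →L[ℝ] ℝ :=
  (ψ '' W).indicator fun y ↦
    (show F →L[ℝ] F →L[ℝ] ℝ from pullbackBilin (I := I) (I' := 𝓘(ℝ, F)) (invFunOn ψ W) b y)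

variable {I}

section PushforwardBasic

variable [Nonempty M] (ψ : M → F) (W : Set M)
  (b : Π x : M, TangentSpace I x →L[ℝ] TangentSpace I x →L[ℝ] ℝ)

/-- Off the chart image the components are the junk value `0`. [folklore] -/
theorem pushforwardBilin_of_not_mem {y : F} (hy : y ∉ ψ '' W) : pushforwardBilin I ψ W b y = 0 :=
  indicator_of_notMem hy _

/-- On the chart image the components are the pullback along the inverse chart. [cite: ONeill1983, Ch. 3, p. 58] -/
theorem pushforwardBilin_of_mem {y : F} (hy : y ∈ ψ '' W) :
    pushforwardBilin I ψ W b y =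
      (show F →L[ℝ] F →L[ℝ] ℝ from pullbackBilin (I := I) (I' := 𝓘(ℝ, F)) (invFunOn ψ W) b y) :=
  indicator_of_mem hy _

/-- Evaluation on the chart image: `(ψ_* b)_y (v, w) = b_{χ y}(dχ_y v, dχ_y w)`, `χ = ψ|_W⁻¹`.
[cite: ONeill1983, Ch. 3, p. 58] -/
theorem pushforwardBilin_apply_of_mem {y : F} (hy : y ∈ ψ '' W) (v w : F) :
    pushforwardBilin I ψ W b y v w =
      b (invFunOn ψ W y) (mfderiv 𝓘(ℝ, F) I (invFunOn ψ W) y v)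
        (mfderiv 𝓘(ℝ, F) I (invFunOn ψ W) y w) := by
  rw [pushforwardBilin_of_mem ψ W b hy]
  rfl

/-- The components of a symmetric field are symmetric. [folklore] -/
theorem pushforwardBilin_comm (hb : ∀ x v w, b x v w = b x w v) (y v w : F) :
    pushforwardBilin I ψ W b y v w = pushforwardBilin I ψ W b y w v := by
  by_cases hy : y ∈ ψ '' W
  · rw [pushforwardBilin_apply_of_mem ψ W b hy, pushforwardBilin_apply_of_mem ψ W b hy, hb]
  · simp [pushforwardBilin_of_not_mem ψ W b hy]

end PushforwardBasic

namespace IsDilationAdaptedChart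

variable {Φ : M → M} {c : ℝ} {W : Set M} {ψ : M → F}

/-! #### Set-theoretic consequences -/

/-- `Φ` maps the chart domain into itself. [folklore] -/
theorem mapsTo (h : IsDilationAdaptedChart I Φ c W ψ) : MapsTo Φ W W :=
  mapsTo_iff_image_subset.mpr h.image_eq.subset

/-- `Φ` maps the chart domain onto itself. [folklore] -/
theorem surjOn (h : IsDilationAdaptedChart I Φ c W ψ) : SurjOn Φ W W :=
  h.image_eq.symm.subset

/-- `ψ` is injective on the chart domain (it has a left inverse there). [folklore] -/
theorem injOn (h : IsDilationAdaptedChart I Φ c W ψ) : InjOn ψ W := by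
  obtain ⟨χ, -, hχ⟩ := h.exists_leftInvOn
  exact hχ.injOn

/-- `ψ` is continuous on the chart domain. [folklore] -/
theorem continuousOn (h : IsDilationAdaptedChart I Φ c W ψ) : ContinuousOn ψ W :=
  h.contMDiffOn.continuousOn

/-- `ψ` is differentiable at the points of the chart domain. [folklore] -/
theorem mdifferentiableAt (h : IsDilationAdaptedChart I Φ c W ψ) {x : M} (hx : x ∈ W) :
    MDifferentiableAt I 𝓘(ℝ, F) ψ x :=
  (h.contMDiffOn.contMDiffAt (h.isOpen.mem_nhds hx)).mdifferentiableAt (by simp)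

/-- The origin is not a point of the chart image (it is the ideal vertex). [folklore] -/
theorem zero_not_mem_image (h : IsDilationAdaptedChart I Φ c W ψ) : (0 : F) ∉ ψ '' W := by
  rintro ⟨x, hx, h0⟩
  exact h.apply_ne_zero x hx h0

/-! #### The canonical inverse `Function.invFunOn ψ W` -/

section Inverse

variable [Nonempty M]

/-- `χ (ψ x) = x` on `W` for the canonical inverse `χ = Function.invFunOn ψ W`. [folklore] -/
theorem leftInvOn_invFunOn (h : IsDilationAdaptedChart I Φ c W ψ) : LeftInvOn (invFunOn ψ W) ψ W :=
  h.injOn.leftInvOn_invFunOn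

omit [TopologicalSpace M] [NormedAddCommGroup F] [NormedSpace ℝ F] in
/-- `χ y ∈ W` for `y` in the chart image. [folklore] -/
theorem invFunOn_mem {y : F} (hy : y ∈ ψ '' W) : invFunOn ψ W y ∈ W :=
  Function.invFunOn_mem (f := ψ) hy

omit [TopologicalSpace M] [NormedAddCommGroup F] [NormedSpace ℝ F] in
/-- `ψ (χ y) = y` for `y` in the chart image. [folklore] -/
theorem apply_invFunOn {y : F} (hy : y ∈ ψ '' W) : ψ (invFunOn ψ W y) = y :=
  Function.invFunOn_eq (f := ψ) hy

/-- **The canonical inverse is smooth on the chart image** (it agrees there with the smooth left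
inverse of the definition). [folklore] -/
theorem contMDiffOn_invFunOn (h : IsDilationAdaptedChart I Φ c W ψ) :
    ContMDiffOn 𝓘(ℝ, F) I ∞ (invFunOn ψ W) (ψ '' W) := by
  obtain ⟨χ, hχs, hχ⟩ := h.exists_leftInvOn
  refine hχs.congr ?_
  rintro _ ⟨x, hx, rfl⟩
  rw [h.leftInvOn_invFunOn hx, hχ hx]

/-- The canonical inverse is differentiable at the points of the chart image. [folklore] -/
theorem mdifferentiableAt_invFunOn (h : IsDilationAdaptedChart I Φ c W ψ) {y : F} (hy : y ∈ ψ '' W) :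
    MDifferentiableAt 𝓘(ℝ, F) I (invFunOn ψ W) y :=
  (h.contMDiffOn_invFunOn.contMDiffAt (h.isOpen_image.mem_nhds hy)).mdifferentiableAt (by simp)

/-- Near a point of `W`, `χ ∘ ψ = id`. [folklore] -/
theorem invFunOn_comp_eventuallyEq (h : IsDilationAdaptedChart I Φ c W ψ) {x : M} (hx : x ∈ W) :
    (invFunOn ψ W ∘ ψ) =ᶠ[𝓝 x] id := by
  filter_upwards [h.isOpen.mem_nhds hx] with x' hx' using h.leftInvOn_invFunOn hx'

/-- Near a point of the chart image, `ψ ∘ χ = id`. [folklore] -/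
theorem comp_invFunOn_eventuallyEq (h : IsDilationAdaptedChart I Φ c W ψ) {y : F} (hy : y ∈ ψ '' W) :
    (ψ ∘ invFunOn ψ W) =ᶠ[𝓝 y] id := by
  filter_upwards [h.isOpen_image.mem_nhds hy] with y' hy' using apply_invFunOn hy'

/-- **`dχ ∘ dψ = id`** on `W`: `dχ_{ψ x}(dψ_x v) = v`. [folklore] -/
theorem mfderiv_invFunOn_mfderiv (h : IsDilationAdaptedChart I Φ c W ψ) {x : M} (hx : x ∈ W)
    (v : TangentSpace I x) :
    mfderiv 𝓘(ℝ, F) I (invFunOn ψ W) (ψ x) (mfderiv I 𝓘(ℝ, F) ψ x v) = v := by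
  have hd := (h.invFunOn_comp_eventuallyEq hx).mfderiv_eq (I := I) (I' := I)
  rw [mfderiv_comp x (h.mdifferentiableAt_invFunOn (mem_image_of_mem ψ hx)) (h.mdifferentiableAt hx),
    mfderiv_id] at hd
  exact DFunLike.congr_fun hd v

/-- **`dψ ∘ dχ = id`** on the chart image: `dψ_{χ y}(dχ_y e) = e`. [folklore] -/
theorem mfderiv_mfderiv_invFunOn (h : IsDilationAdaptedChart I Φ c W ψ) {y : F} (hy : y ∈ ψ '' W)
    (e : F) :
    mfderiv I 𝓘(ℝ, F) ψ (invFunOn ψ W y) (mfderiv 𝓘(ℝ, F) I (invFunOn ψ W) y e) = e := by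
  have hd := (h.comp_invFunOn_eventuallyEq hy).mfderiv_eq (I := 𝓘(ℝ, F)) (I' := 𝓘(ℝ, F))
  rw [mfderiv_comp y (h.mdifferentiableAt (invFunOn_mem hy)) (h.mdifferentiableAt_invFunOn hy),
    mfderiv_id] at hd
  exact DFunLike.congr_fun hd e

/-- **`ψ|_W` is open**: the image of an open subset of `W` is open (it is the preimage of that subset
under the continuous inverse, inside the open image). [folklore] -/
theorem isOpen_image_of_subset (h : IsDilationAdaptedChart I Φ c W ψ) {V : Set M} (hV : IsOpen V)
    (hVW : V ⊆ W) : IsOpen (ψ '' V) := by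
  have hEq : ψ '' V = ψ '' W ∩ invFunOn ψ W ⁻¹' V := by
    ext y
    constructor
    · rintro ⟨x, hx, rfl⟩
      exact ⟨mem_image_of_mem ψ (hVW hx), by
        rw [mem_preimage, h.leftInvOn_invFunOn (hVW hx)]; exact hx⟩
    · rintro ⟨hy, hyV⟩
      exact ⟨invFunOn ψ W y, hyV, apply_invFunOn hy⟩
  rw [hEq]
  exact h.contMDiffOn_invFunOn.continuousOn.isOpen_inter_preimage h.isOpen_image hV

/-- **`ψ|_W` is an open embedding** of `W` into `F` (the form used for the local parametrisations of
`TangentProfile.lean`). [folklore] -/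
theorem isOpenEmbedding_restrict (h : IsDilationAdaptedChart I Φ c W ψ) :
    IsOpenEmbedding (W.restrict ψ) := by
  rw [isOpenEmbedding_iff_continuous_injective_isOpenMap]
  refine ⟨h.continuousOn.restrict, injOn_iff_injective.mp h.injOn, fun U hU ↦ ?_⟩
  obtain ⟨V, hV, rfl⟩ := isOpen_induced_iff.mp hU
  rw [restrict_eq, image_comp, Subtype.image_preimage_coe]
  exact h.isOpen_image_of_subset (h.isOpen.inter hV) inter_subset_left

end Inverse

/-! #### The dilation on the chart image -/

/-- `c • ψ x` lies in the chart image for `x ∈ W` (it is `ψ (Φ x)`). [cite: GundlachMartingarcia2007, §2.2] -/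
theorem smul_apply_mem_image (h : IsDilationAdaptedChart I Φ c W ψ) {x : M} (hx : x ∈ W) :
    c • ψ x ∈ ψ '' W :=
  ⟨Φ x, h.mapsTo hx, h.apply_map x hx⟩

/-- The chart image is mapped into itself by the dilation. [cite: GundlachMartingarcia2007, §2.2] -/
theorem smul_mem_image (h : IsDilationAdaptedChart I Φ c W ψ) {y : F} (hy : y ∈ ψ '' W) :
    c • y ∈ ψ '' W := by
  obtain ⟨x, hx, rfl⟩ := hy
  exact h.smul_apply_mem_image hx

/-- Every point of the chart image is the dilate of a point of the chart image. [cite: GundlachMartingarcia2007, §2.2] -/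
theorem exists_eq_smul (h : IsDilationAdaptedChart I Φ c W ψ) {y : F} (hy : y ∈ ψ '' W) :
    ∃ y' ∈ ψ '' W, y = c • y' := by
  obtain ⟨x, hx, rfl⟩ := hy
  obtain ⟨x', hx', rfl⟩ := h.surjOn hx
  exact ⟨ψ x', mem_image_of_mem ψ hx', h.apply_map x' hx'⟩

/-- **The chart image is dilation invariant**: `c • ψ(W) = ψ(W)`. [cite: GundlachMartingarcia2007, §2.2] -/
theorem smul_image_eq (h : IsDilationAdaptedChart I Φ c W ψ) : c • ψ '' W = ψ '' W := by
  ext y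
  rw [mem_smul_set]
  constructor
  · rintro ⟨y', hy', rfl⟩
    exact h.smul_mem_image hy'
  · intro hy
    obtain ⟨y', hy', rfl⟩ := h.exists_eq_smul hy
    exact ⟨y', hy', rfl⟩

/-- More generally, the image of a `Φ`-invariant subset of `W` (e.g. the past of the vertex) is
dilation invariant. [cite: GundlachMartingarcia2007, §2.2] -/
theorem smul_image_eq_of_image_eq (h : IsDilationAdaptedChart I Φ c W ψ) {S : Set M} (hSW : S ⊆ W)
    (hS : Φ '' S = S) : c • ψ '' S = ψ '' S := by
  ext y
  rw [mem_smul_set]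
  constructor
  · rintro ⟨_, ⟨x, hx, rfl⟩, rfl⟩
    exact ⟨Φ x, hS.le (mem_image_of_mem Φ hx), h.apply_map x (hSW hx)⟩
  · rintro ⟨x, hx, rfl⟩
    obtain ⟨x', hx', rfl⟩ := hS.ge hx
    exact ⟨ψ x', mem_image_of_mem ψ hx', (h.apply_map x' (hSW hx')).symm⟩

/-- For `c ≠ 0`: `c • y ∈ ψ(W) ↔ y ∈ ψ(W)`. [folklore] -/
theorem smul_mem_image_iff (h : IsDilationAdaptedChart I Φ c W ψ) (hc : c ≠ 0) (y : F) :
    c • y ∈ ψ '' W ↔ y ∈ ψ '' W := by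
  rw [← smul_mem_smul_set_iff₀ hc (ψ '' W) y, h.smul_image_eq]

/-- **Orbits of `Φ` are rays of dilates**: `ψ (Φ^[k] x) = c ^ k • ψ x`. [cite: GundlachMartingarcia2007, §2.2] -/
theorem apply_iterate (h : IsDilationAdaptedChart I Φ c W ψ) {x : M} (hx : x ∈ W) (k : ℕ) :
    ψ (Φ^[k] x) = c ^ k • ψ x := by
  induction k with
  | zero => simp
  | succ k ih =>
    rw [iterate_succ_apply', h.apply_map _ (h.mapsTo.iterate k hx), ih, smul_smul, pow_succ']

/-- **The vertex sits at the origin**: for `|c| < 1` the images of the `Φ`-orbit of a point of `W`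
tend to `0`. [cite: GundlachMartingarcia2007, §2.2] -/
theorem tendsto_apply_iterate (h : IsDilationAdaptedChart I Φ c W ψ) (hc : |c| < 1) {x : M}
    (hx : x ∈ W) : Tendsto (fun k : ℕ ↦ ψ (Φ^[k] x)) atTop (𝓝 0) := by
  simp_rw [h.apply_iterate hx]
  simpa using (tendsto_pow_atTop_nhds_zero_of_abs_lt_one hc).smul_const (ψ x)

/-- For `|c| < 1` and `W ≠ ∅` the origin is in the closure of the chart image (though not in the
image, `zero_not_mem_image`). [cite: GundlachMartingarcia2007, §2.2] -/
theorem zero_mem_closure_image (h : IsDilationAdaptedChart I Φ c W ψ) (hc : |c| < 1)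
    (hW : W.Nonempty) : (0 : F) ∈ closure (ψ '' W) := by
  obtain ⟨x, hx⟩ := hW
  exact mem_closure_of_tendsto (h.tendsto_apply_iterate hc hx)
    (Eventually.of_forall fun k ↦ mem_image_of_mem ψ (h.mapsTo.iterate k hx))

/-! #### The components in an adapted chart -/

section Components

variable [Nonempty M] (b : Π x : M, TangentSpace I x →L[ℝ] TangentSpace I x →L[ℝ] ℝ)

/-- **`ψ|_W` is an isometry onto its image for the pushed-forward components**:
`(ψ_* b)_{ψ x}(dψ_x v, dψ_x w) = b_x(v, w)` for `x ∈ W` (O'Neill 1983, Ch. 3, Def. 6, p. 58: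
`⟨dφ(v), dφ(w)⟩ = ⟨v, w⟩`). [cite: ONeill1983, Ch. 3, Def. 6 (p. 58)] -/
theorem pushforwardBilin_apply_mfderiv (h : IsDilationAdaptedChart I Φ c W ψ) {x : M} (hx : x ∈ W)
    (v w : TangentSpace I x) :
    pushforwardBilin I ψ W b (ψ x) (mfderiv I 𝓘(ℝ, F) ψ x v) (mfderiv I 𝓘(ℝ, F) ψ x w) = b x v w := by
  rw [pushforwardBilin_apply_of_mem ψ W b (mem_image_of_mem ψ hx), h.mfderiv_invFunOn_mfderiv hx,
    h.mfderiv_invFunOn_mfderiv hx, h.leftInvOn_invFunOn hx]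

/-- **Nondegeneracy is preserved**: if `b` is nondegenerate on `W`, its components are nondegenerate
on the chart image (`dχ` is a linear isomorphism there). [folklore] -/
theorem pushforwardBilin_nondegenerate (h : IsDilationAdaptedChart I Φ c W ψ)
    (hb : ∀ x ∈ W, ∀ v : TangentSpace I x, (∀ w, b x v w = 0) → v = 0) {y : F} (hy : y ∈ ψ '' W)
    (e : F) (he : ∀ e', pushforwardBilin I ψ W b y e e' = 0) : e = 0 := by
  have hχ : mfderiv 𝓘(ℝ, F) I (invFunOn ψ W) y e = 0 := by
    refine hb _ (invFunOn_mem hy) _ fun w ↦ ?_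
    obtain ⟨x, hx, rfl⟩ := hy
    have hw := h.mfderiv_invFunOn_mfderiv (invFunOn_mem (mem_image_of_mem ψ hx)) w
    rw [apply_invFunOn (mem_image_of_mem ψ hx)] at hw
    rw [← hw, ← pushforwardBilin_apply_of_mem ψ W b (mem_image_of_mem ψ hx)]
    exact he _
  rw [← h.mfderiv_mfderiv_invFunOn hy e, hχ, map_zero]
  rfl

/-- **Scaling law.** If `Φ` is differentiable on `W` and rescales `b` by the constant factor `c²`
there (`Φ^* b = c² b`: a homothety of scale factor `c`, O'Neill 1983, Ch. 3, Def. 3.63), then the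
components of `b` in a dilation-adapted chart are **invariant under the dilation by `c`**:
`(ψ_* b)(c • y) = (ψ_* b)(y)` — the chart-level form `g_{αβ}(cX) = g_{αβ}(X)` of self-similarity
(Gundlach–Martín-García 2007, §2.2, `g_{μν} = e^{-2τ} g̃_{μν}` with `g̃` independent of, resp.
periodic in, `τ`). Off the image both sides are the junk `0`. [cite: GundlachMartingarcia2007, §2.2] -/
theorem pushforwardBilin_smul (h : IsDilationAdaptedChart I Φ c W ψ) (hc : c ≠ 0)
    (hΦ : ∀ x ∈ W, MDifferentiableAt I I Φ x)
    (hb : ∀ x ∈ W, ∀ v w : TangentSpace I x,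
      b (Φ x) (mfderiv I I Φ x v) (mfderiv I I Φ x w) = c ^ 2 * b x v w)
    (y : F) : pushforwardBilin I ψ W b (c • y) = pushforwardBilin I ψ W b y := by
  by_cases hy : y ∈ ψ '' W
  swap
  · rw [pushforwardBilin_of_not_mem ψ W b hy,
      pushforwardBilin_of_not_mem ψ W b (mt (h.smul_mem_image_iff hc y).mp hy)]
  -- the dilation `z ↦ c • z` and its derivative
  have hLd : HasMFDerivAt 𝓘(ℝ, F) 𝓘(ℝ, F) (fun z : F ↦ c • z) y (c • ContinuousLinearMap.id ℝ F) :=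
    ((c • ContinuousLinearMap.id ℝ F).hasFDerivAt.congr_of_eventuallyEq
      (Eventually.of_forall fun z ↦ by simp)).hasMFDerivAt
  -- `χ ∘ (c • ·) = Φ ∘ χ` near `y`
  have hev : (invFunOn ψ W ∘ fun z : F ↦ c • z) =ᶠ[𝓝 y] (Φ ∘ invFunOn ψ W) := by
    filter_upwards [h.isOpen_image.mem_nhds hy]
    rintro _ ⟨x, hx, rfl⟩
    simp only [comp_apply, ← h.apply_map x hx, h.leftInvOn_invFunOn hx,
      h.leftInvOn_invFunOn (h.mapsTo hx)]
  have hχy : invFunOn ψ W (c • y) = Φ (invFunOn ψ W y) := by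
    simpa only [comp_apply] using hev.eq_of_nhds
  have hd := hev.mfderiv_eq (I := 𝓘(ℝ, F)) (I' := I)
  rw [mfderiv_comp y (h.mdifferentiableAt_invFunOn (h.smul_mem_image hy)) hLd.mdifferentiableAt,
    hLd.mfderiv, mfderiv_comp y (hΦ _ (invFunOn_mem hy)) (h.mdifferentiableAt_invFunOn hy)] at hd
  -- `dχ_{c y}(c u) = dΦ (dχ_y u)`, hence `dχ_{c y} u = c⁻¹ dΦ (dχ_y u)`
  have key : ∀ u : TangentSpace 𝓘(ℝ, F) y, mfderiv 𝓘(ℝ, F) I (invFunOn ψ W) (c • y) u =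
      c⁻¹ • mfderiv I I Φ (invFunOn ψ W y) (mfderiv 𝓘(ℝ, F) I (invFunOn ψ W) y u) := by
    intro u
    have hu := DFunLike.congr_fun hd (c⁻¹ • u)
    -- left side of `hu`: `(c • id) (c⁻¹ • u) = u` (definitional unfolding of `comp`, `smul`)
    have h1 : ((mfderiv 𝓘(ℝ, F) I (invFunOn ψ W) ((fun z : F ↦ c • z) y)).comp
        (c • ContinuousLinearMap.id ℝ F)) (c⁻¹ • u) =
          mfderiv 𝓘(ℝ, F) I (invFunOn ψ W) (c • y) u := by
      change mfderiv 𝓘(ℝ, F) I (invFunOn ψ W) (c • y) (c • (c⁻¹ • u)) = _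
      rw [smul_inv_smul₀ hc]
    -- right side of `hu`: linearity
    have h2 : ((mfderiv I I Φ (invFunOn ψ W y)).comp (mfderiv 𝓘(ℝ, F) I (invFunOn ψ W) y))
        (c⁻¹ • u) = c⁻¹ • mfderiv I I Φ (invFunOn ψ W y) (mfderiv 𝓘(ℝ, F) I (invFunOn ψ W) y u) := by
      rw [ContinuousLinearMap.comp_apply, map_smul, map_smul]
    exact h1.symm.trans (hu.trans h2)
  ext v w
  rw [pushforwardBilin_apply_of_mem ψ W b (h.smul_mem_image hy),
    pushforwardBilin_apply_of_mem ψ W b hy, key v, key w, hχy, map_smul, map_smul,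
    FunLike.coe_smul, Pi.smul_apply, smul_eq_mul, smul_eq_mul, hb _ (invFunOn_mem hy)]
  field_simp

end Components

end IsDilationAdaptedChart

end Generic

/-! ### Homothety-adapted charts of a self-similar vacuum profile -/

namespace SelfSimilarVacuumProfile

universe u

variable {n : ℕ∞ω} [Fact (1 ≤ n)] (Z : SelfSimilarVacuumProfile.{u} n)

/-- A **homothety-adapted chart** of the self-similar vacuum profile `Z` on the region `W ⊆ M`: a
dilation-adapted chart (`IsDilationAdaptedChart`) for the CONTRACTION `Φ⁻¹ = Z.dilation.symm` with scale
factor `e^{-Δ}`, `Δ = Z.logScale` — `W` is open with `Φ(W) = W`, `ψ : M → E4` is a diffeomorphism of `W`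
onto the open set `ψ(W) ⊆ ℝ⁴` (smooth, smooth inverse on the image), `ψ (Φ⁻¹ x) = e^{-Δ} • ψ x` on `W`,
and `0 ∉ ψ(W)`. In such coordinates the discrete homothety `Φ^* g = e^{2Δ} g` is the linear dilation by
`e^{Δ}` about the origin, the ideal vertex is the origin (`ψ (Φ^{-k} x) = e^{-kΔ} ψ x → 0`), and the
metric components are invariant under the admissible scale factor `e^{-Δ}`
(`IsHomothetyAdaptedChart.chartMetric_smul`): the Cartesian form (`X = e^{-τ} ι(xⁱ)`, vertex at
`X = 0`, as in `SelfSimilarUnstableMode.lean`) of the coordinates adapted to the symmetry of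
Gundlach–Martín-García 2007, §2.2 (`ξ = -∂_τ`, `g_{μν}(τ, xⁱ) = e^{-2τ} g̃_{μν}`, `g̃` `Δ`-periodic in `τ`
for DSS), and of the self-similar double-null coordinates of Rodnianski–Shlapentokh-Rothman 2023,
Def. 2.3 (`K = u∂_u + v∂_v`). Intended region: `W = Z.past ∪ N`, `N` a `Φ`-invariant open
neighbourhood of `Z.cone`. Twisted profiles are covered in this untwisted normal form (module
docstring). No existence is asserted. [cite: GundlachMartingarcia2007, §2.2] -/
abbrev IsHomothetyAdaptedChart (W : Set Z.carrier) (ψ : Z.carrier → E4) : Prop :=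
  IsDilationAdaptedChart (𝓡 4) Z.dilation.symm (Real.exp (-Z.logScale)) W ψ

/-- The **metric components in the chart** `ψ|_W`: `(ψ|_W⁻¹)^* g` on `ψ '' W` (an honest field of
continuous bilinear forms on `E4`, like `metricInChart` and `Spacetime.blowupDeviation`), junk `0` off
`ψ '' W`; these are the components `Zc : E4 → E4 →L[ℝ] E4 →L[ℝ] ℝ` fed to `HasSmoothUnstableMode`
(metric components in a coordinate system, O'Neill 1983, Ch. 3, pp. 55–56). [cite: ONeill1983, Ch. 3, pp. 55–56] -/
def chartMetric (W : Set Z.carrier) (ψ : Z.carrier → E4) : E4 → E4 →L[ℝ] E4 →L[ℝ] ℝ :=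
  pushforwardBilin (𝓡 4) ψ W Z.metric.val

/-- **Smooth unstable mode in a homothety-adapted chart** — the bridge to `SelfSimilarUnstableMode.lean`:
the components `Z.chartMetric W ψ` have a `C^m` unstable mode (`HasSmoothUnstableMode`: an exponent `μ`,
`Re μ > 0`, and a non-pure-gauge `C^m` mode solution of the linearised vacuum equations, homogeneous of
degree `-μ`) on the chart image `ψ '' W`, for the admissible scale factor `e^{-Δ}` of the profile
(Floquet form; Gundlach–Martín-García 2007, §2.3; Costin–Donninger–Glogić 2016, §2.2). Meaningful when
`Z.IsHomothetyAdaptedChart W ψ`. [cite: CostinDonningerGlogic2016, §2.2] -/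
def HasSmoothUnstableModeInChart (W : Set Z.carrier) (ψ : Z.carrier → E4) (m : ℕ∞ω) : Prop :=
  HasSmoothUnstableMode (Z.chartMetric W ψ) {Real.exp (-Z.logScale)} (ψ '' W) m

/-- Unfolding lemma for `HasSmoothUnstableModeInChart`. [cite: CostinDonningerGlogic2016, §2.2] -/
theorem hasSmoothUnstableModeInChart_iff (W : Set Z.carrier) (ψ : Z.carrier → E4) (m : ℕ∞ω) :
    Z.HasSmoothUnstableModeInChart W ψ m ↔
      HasSmoothUnstableMode (Z.chartMetric W ψ) {Real.exp (-Z.logScale)} (ψ '' W) m :=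
  Iff.rfl

/-- Antitone in the regularity class (from `HasSmoothUnstableMode.of_le`). [folklore] -/
theorem HasSmoothUnstableModeInChart.of_le {Z : SelfSimilarVacuumProfile.{u} n} {W : Set Z.carrier}
    {ψ : Z.carrier → E4} {m m' : ℕ∞ω} (h : Z.HasSmoothUnstableModeInChart W ψ m') (hm : m ≤ m') :
    Z.HasSmoothUnstableModeInChart W ψ m :=
  HasSmoothUnstableMode.of_le h hm

/-- The admissible scale factor `e^{-Δ}` of the contraction is positive. [folklore] -/
lemma exp_neg_logScale_pos : 0 < Real.exp (-Z.logScale) := Real.exp_pos _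

/-- The admissible scale factor `e^{-Δ}` of the contraction is `< 1` (`Δ > 0`). [folklore] -/
lemma exp_neg_logScale_lt_one : Real.exp (-Z.logScale) < 1 :=
  Real.exp_lt_one_iff.mpr (neg_lt_zero.mpr Z.logScale_pos)

/-- `|e^{-Δ}| < 1`. [folklore] -/
lemma abs_exp_neg_logScale_lt_one : |Real.exp (-Z.logScale)| < 1 := by
  rw [abs_of_pos Z.exp_neg_logScale_pos]
  exact Z.exp_neg_logScale_lt_one

/-- `e^{-kΔ} • y → 0` as `k → ∞`: iterating the linearised contraction drives every point of `E4`
to the origin, the seat of the ideal vertex. [folklore] -/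
lemma tendsto_exp_neg_logScale_pow_smul (y : E4) :
    Tendsto (fun k : ℕ ↦ Real.exp (-Z.logScale) ^ k • y) atTop (𝓝 0) := by
  simpa using (tendsto_pow_atTop_nhds_zero_of_abs_lt_one Z.abs_exp_neg_logScale_lt_one).smul_const y

/-- The contraction `Φ⁻¹` maps the past of the vertex onto itself: `Φ⁻¹(P) = P`.
[cite: ShlapentokhRothman2023twisted, Def. 4.1] -/
theorem image_dilation_symm_past : Z.dilation.symm '' Z.past = Z.past := by
  ext x
  constructor
  · rintro ⟨y, hy, rfl⟩
    exact Z.dilation_symm_mem_past hy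
  · intro hx
    exact ⟨Z.dilation x, Z.dilation_mem_past hx, Z.dilation.symm_apply_apply x⟩

/-- Off the chart image the components are the junk value `0`. [folklore] -/
theorem chartMetric_of_not_mem {W : Set Z.carrier} {ψ : Z.carrier → E4} {y : E4} (hy : y ∉ ψ '' W) :
    Z.chartMetric W ψ y = 0 :=
  pushforwardBilin_of_not_mem ψ W _ hy

/-- Evaluation of the components on the chart image: `g_{χ y}(dχ_y v, dχ_y w)`, `χ = ψ|_W⁻¹`.
[cite: ONeill1983, Ch. 3, pp. 55–58] -/
theorem chartMetric_apply_of_mem {W : Set Z.carrier} {ψ : Z.carrier → E4} {y : E4} (hy : y ∈ ψ '' W)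
    (v w : E4) :
    Z.chartMetric W ψ y v w =
      Z.metric.val (invFunOn ψ W y) (mfderiv 𝓘(ℝ, E4) (𝓡 4) (invFunOn ψ W) y v)
        (mfderiv 𝓘(ℝ, E4) (𝓡 4) (invFunOn ψ W) y w) :=
  pushforwardBilin_apply_of_mem ψ W _ hy v w

/-- The components are symmetric. [folklore] -/
theorem chartMetric_comm (W : Set Z.carrier) (ψ : Z.carrier → E4) (y v w : E4) :
    Z.chartMetric W ψ y v w = Z.chartMetric W ψ y w v :=
  pushforwardBilin_comm ψ W _ Z.metric.symm y v w

namespace IsHomothetyAdaptedChart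

variable {Z} {W : Set Z.carrier} {ψ : Z.carrier → E4}

/-- `ψ (Φ⁻¹ x) = e^{-Δ} • ψ x` on `W`. [cite: GundlachMartingarcia2007, §2.2] -/
theorem apply_dilation_symm (h : Z.IsHomothetyAdaptedChart W ψ) {x : Z.carrier} (hx : x ∈ W) :
    ψ (Z.dilation.symm x) = Real.exp (-Z.logScale) • ψ x :=
  h.apply_map x hx

/-- `Φ⁻¹ x ∈ W` for `x ∈ W`. [folklore] -/
theorem dilation_symm_mem (h : Z.IsHomothetyAdaptedChart W ψ) {x : Z.carrier} (hx : x ∈ W) :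
    Z.dilation.symm x ∈ W :=
  h.mapsTo hx

/-- `Φ x ∈ W` for `x ∈ W`. [folklore] -/
theorem dilation_mem (h : Z.IsHomothetyAdaptedChart W ψ) {x : Z.carrier} (hx : x ∈ W) :
    Z.dilation x ∈ W := by
  obtain ⟨x', hx', hxx'⟩ := h.surjOn hx
  rw [← hxx', Diffeomorph.apply_symm_apply]
  exact hx'

/-- `Φ(W) = W`. [folklore] -/
theorem image_dilation_eq (h : Z.IsHomothetyAdaptedChart W ψ) : Z.dilation '' W = W := by
  ext x
  constructor
  · rintro ⟨y, hy, rfl⟩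
    exact h.dilation_mem hy
  · intro hx
    exact ⟨Z.dilation.symm x, h.dilation_symm_mem hx, Z.dilation.apply_symm_apply x⟩

/-- **Expansion form**: `ψ (Φ x) = e^{Δ} • ψ x` on `W`. [cite: GundlachMartingarcia2007, §2.2] -/
theorem apply_dilation (h : Z.IsHomothetyAdaptedChart W ψ) {x : Z.carrier} (hx : x ∈ W) :
    ψ (Z.dilation x) = Real.exp Z.logScale • ψ x := by
  have h1 := h.apply_dilation_symm (h.dilation_mem hx)
  rw [Diffeomorph.symm_apply_apply] at h1
  rw [h1, smul_smul, ← Real.exp_add, add_neg_cancel, Real.exp_zero, one_smul]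

/-- `ψ (Φ^{-k} x) = e^{-kΔ} • ψ x`. [cite: GundlachMartingarcia2007, §2.2] -/
theorem apply_dilation_symm_iterate (h : Z.IsHomothetyAdaptedChart W ψ) {x : Z.carrier} (hx : x ∈ W)
    (k : ℕ) : ψ (Z.dilation.symm^[k] x) = Real.exp (-(k * Z.logScale)) • ψ x := by
  rw [h.apply_iterate hx k, ← Real.exp_nat_mul, mul_neg]

/-- **The ideal vertex sits at the origin**: `ψ (Φ^{-k} x) → 0` for `x ∈ W`. [cite: GundlachMartingarcia2007, §2.2] -/
theorem tendsto_apply_dilation_symm_iterate (h : Z.IsHomothetyAdaptedChart W ψ) {x : Z.carrier}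
    (hx : x ∈ W) : Tendsto (fun k : ℕ ↦ ψ (Z.dilation.symm^[k] x)) atTop (𝓝 0) :=
  h.tendsto_apply_iterate Z.abs_exp_neg_logScale_lt_one hx

/-- The origin is in the closure of the image of a nonempty chart domain, but not in the image.
[cite: GundlachMartingarcia2007, §2.2] -/
theorem zero_mem_closure_image_diff (h : Z.IsHomothetyAdaptedChart W ψ) (hW : W.Nonempty) :
    (0 : E4) ∈ closure (ψ '' W) \ ψ '' W :=
  ⟨h.zero_mem_closure_image Z.abs_exp_neg_logScale_lt_one hW, h.zero_not_mem_image⟩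

/-- `e^{-Δ} • y ∈ ψ(W) ↔ y ∈ ψ(W)`. [folklore] -/
theorem exp_smul_mem_image_iff (h : Z.IsHomothetyAdaptedChart W ψ) (y : E4) :
    Real.exp (-Z.logScale) • y ∈ ψ '' W ↔ y ∈ ψ '' W :=
  h.smul_mem_image_iff (Real.exp_pos _).ne' y

/-- **The image of the past of the vertex is dilation invariant** (when the chart covers it):
`e^{-Δ} • ψ(P) = ψ(P)`. [cite: GundlachMartingarcia2007, §2.2] -/
theorem smul_image_past (h : Z.IsHomothetyAdaptedChart W ψ) (hP : Z.past ⊆ W) :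
    Real.exp (-Z.logScale) • ψ '' Z.past = ψ '' Z.past :=
  h.smul_image_eq_of_image_eq hP Z.image_dilation_symm_past

/-- The image of the past of the vertex is open (when the chart covers it). [folklore] -/
theorem isOpen_image_past (h : Z.IsHomothetyAdaptedChart W ψ) (hP : Z.past ⊆ W) :
    IsOpen (ψ '' Z.past) :=
  h.isOpen_image_of_subset Z.isOpen_past hP

/-- **`ψ|_W` is an isometry onto `(ψ(W), chartMetric)`**: `chartMetric (ψ x) (dψ v, dψ w) = g_x(v, w)`.
[cite: ONeill1983, Ch. 3, Def. 6 (p. 58)] -/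
theorem chartMetric_apply_mfderiv (h : Z.IsHomothetyAdaptedChart W ψ) {x : Z.carrier} (hx : x ∈ W)
    (v w : TangentSpace (𝓡 4) x) :
    Z.chartMetric W ψ (ψ x) (mfderiv (𝓡 4) 𝓘(ℝ, E4) ψ x v) (mfderiv (𝓡 4) 𝓘(ℝ, E4) ψ x w) =
      Z.metric.val x v w :=
  h.pushforwardBilin_apply_mfderiv _ hx v w

/-- **The components are nondegenerate on the chart image.** [folklore] -/
theorem chartMetric_nondegenerate (h : Z.IsHomothetyAdaptedChart W ψ) {y : E4} (hy : y ∈ ψ '' W)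
    (e : E4) (he : ∀ e', Z.chartMetric W ψ y e e' = 0) : e = 0 :=
  h.pushforwardBilin_nondegenerate _ (fun x _ v hv ↦ Z.metric.nondegenerate x v hv) hy e he

/-- **Scaling law (dilation invariance of the components).** For a homothety-adapted chart,
`chartMetric (e^{-Δ} • y) = chartMetric y` for every `y : E4`: from `(Φ⁻¹)^* g = e^{-2Δ} g`
(`isHomothety_dilation_symm`) and `ψ ∘ Φ⁻¹ = e^{-Δ} • ψ`, the conformal weight `e^{-2Δ}` of `g` is
exactly absorbed by the weight of the coordinate differentials, so the components are homogeneous of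
degree `0` — the form `Z (c • x) = Z x`, `c ∈ scales = {e^{-Δ}}`, of discrete self-similarity in
homothety-adapted coordinates quoted in `SelfSimilarUnstableMode.lean` (Gundlach–Martín-García 2007,
§2.2). [cite: GundlachMartingarcia2007, §2.2] -/
theorem chartMetric_smul (h : Z.IsHomothetyAdaptedChart W ψ) (y : E4) :
    Z.chartMetric W ψ (Real.exp (-Z.logScale) • y) = Z.chartMetric W ψ y := by
  refine h.pushforwardBilin_smul _ (Real.exp_pos _).ne'
    (fun x _ ↦ Z.dilation.symm.mdifferentiable (by simp) x) (fun x _ v w ↦ ?_) y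
  rw [Z.isHomothety_dilation_symm.val_mfderiv x v w, ← Real.exp_nat_mul]
  norm_num

/-- Iterated scaling law: `chartMetric (e^{-kΔ} • y) = chartMetric y`. [cite: GundlachMartingarcia2007, §2.2] -/
theorem chartMetric_smul_iterate (h : Z.IsHomothetyAdaptedChart W ψ) (y : E4) (k : ℕ) :
    Z.chartMetric W ψ (Real.exp (-Z.logScale) ^ k • y) = Z.chartMetric W ψ y := by
  induction k with
  | zero => simp
  | succ k ih => rw [pow_succ', mul_smul, h.chartMetric_smul, ih]

/-- Expansion form of the scaling law: `chartMetric (e^{Δ} • y) = chartMetric y`. [cite: GundlachMartingarcia2007, §2.2] -/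
theorem chartMetric_inv_smul (h : Z.IsHomothetyAdaptedChart W ψ) (y : E4) :
    Z.chartMetric W ψ (Real.exp Z.logScale • y) = Z.chartMetric W ψ y := by
  have h1 := h.chartMetric_smul (Real.exp Z.logScale • y)
  rw [smul_smul, ← Real.exp_add, neg_add_cancel, Real.exp_zero, one_smul] at h1
  exact h1.symm

end IsHomothetyAdaptedChart

end SelfSimilarVacuumProfile

/-! ### Sanity: the identity chart of Minkowski space minus the origin -/

namespace Minkowski

/-- **The identity chart of `ℝ⁴ ∖ {0}` is dilation-adapted** for the contraction `Φ_c : x ↦ c • x`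
(`c ≠ 0`; `Φ_c = Minkowski.dilation c`) with scale factor `c`, on `W = {x ≠ 0}`: the model case
"Minkowski space minus the origin with `Φ = e^{Δ}•`" of the request, at chart level
(Rodnianski–Shlapentokh-Rothman 2018, §1: Minkowski space is self-similar under the dilations; the
vector space `E4` carries its own manifold structure `𝓘(ℝ, E4)`, which is that of
`Minkowski.spacetime`). [cite: RodnianskiShlapentokhrothman2018, §1] -/
theorem isDilationAdaptedChart_id {c : ℝ} (hc : c ≠ 0) :
    IsDilationAdaptedChart 𝓘(ℝ, E4) (fun x : E4 ↦ c • x) c {x : E4 | x ≠ 0} id where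
  isOpen := isOpen_ne
  image_eq := by
    ext x
    constructor
    · rintro ⟨y, hy, rfl⟩
      exact smul_ne_zero hc hy
    · intro hx
      exact ⟨c⁻¹ • x, smul_ne_zero (inv_ne_zero hc) hx, smul_inv_smul₀ hc x⟩
  contMDiffOn := contMDiff_id.contMDiffOn
  isOpen_image := by rw [image_id]; exact isOpen_ne
  exists_leftInvOn := ⟨id, contMDiff_id.contMDiffOn, fun _ _ ↦ rfl⟩
  apply_map := fun _ _ ↦ rfl
  apply_ne_zero := fun _ hx ↦ hx

/-- In the identity chart the components of the Minkowski metric `η = Minkowski.bilin` (the metric of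
`Minkowski.spacetime`) at `y ≠ 0` are `η` itself — constant, in particular dilation invariant
(`Φ_c^* η = c² η`, `pullbackBilin_dilation`, so the scaling law is an identity here).
[cite: RodnianskiShlapentokhrothman2018, §1] -/
theorem pushforwardBilin_id_apply {y : E4} (hy : y ≠ 0) (v w : E4) :
    pushforwardBilin 𝓘(ℝ, E4) id {x : E4 | x ≠ 0}
      (fun _ : E4 ↦ (bilin : E4 →L[ℝ] E4 →L[ℝ] ℝ)) y v w = bilin v w := by
  have h := isDilationAdaptedChart_id one_ne_zero
  have hy' : y ∈ (id : E4 → E4) '' {x : E4 | x ≠ 0} := ⟨y, hy, rfl⟩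
  have hχ : invFunOn (id : E4 → E4) {x : E4 | x ≠ 0} =ᶠ[𝓝 y] id := by
    filter_upwards [isOpen_ne.mem_nhds hy] with y' hy'
    exact h.leftInvOn_invFunOn hy'
  rw [pushforwardBilin_apply_of_mem _ _ _ hy', hχ.mfderiv_eq (I := 𝓘(ℝ, E4)) (I' := 𝓘(ℝ, E4)),
    mfderiv_id]
  rfl

end Minkowski

end Literature.Geometry.Lorentzian

end
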